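import Literature.Probability.RandomPlanarGeometry.SAWBridgeStickbreak
import Literature.Probability.RandomPlanarGeometry.SAWBridgeConePositivity
import HarnessLib

/-!
# Duminil-Copin–Hammond 2013, Theorem 2.5: the irreducible bridge has infinite mean length; `b_N μ^{-N} → 0`

Topic `Literature/Probability/RandomPlanarGeometry` (assembles `SAWBridgeDiamondPoints.lean` (S3),
`SAWBridgeStickbreak.lean` (S4), `SAWBridgeConePositivity.lean` (S2), `SAWRenewalMeasureSLLN.lean` (S1: the
strong-law inputs `Zd.card_wide_bridges_div_pow_tendsto_zero`, `Zd.renewalBridgeMeasure_cone_tail_tendsto_zero`)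
and the renewal theorem for bridges `SAWBridgeRenewalLimit.lean`).

Source: H. Duminil-Copin, A. Hammond, *Self-avoiding walk is sub-ballistic*, Comm. Math. Phys. 324 (2013)
401–423, arXiv:1205.0401 [DuminilCopinHammond2013]. **Theorem 2.5** (arXiv v1, p. 8): "We have that
`E_iSAB(|γ|) = ∞`", where `P_iSAB(γ) = μ_c^{-|γ|}` on the irreducible bridges (Lemma 2.2 = Kesten's relation,
p. 7); proof §4 "Incompatibility of the renewal theory for bridges" (pp. 18–25). The consequence
`b_N μ^{-N} → 0` (by the renewal theorem, Madras–Slade 1993 Theorem 4.2.2 (b); M–S p. 91: the limit exists and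
equals `1/Σ_k k λ_k μ^{-k}`, "believed … no known proof" that it is `0` at the time) is not a numbered statement
of the paper.

This file (every `ℤ^{d+2}`, `d ≥ 0`, i.e. every dimension `≥ 2`):
* `Zd.not_summable_mul_irreducibleBridgeCount_div_pow` — `Σ_k k λ_k μ^{-k} = ∞` on `ℤ^{d+2}`: the assembly
  of S1–S4 into the contradiction of DCH §4, eqs. (4.5), (4.9)–(4.10) (arXiv v1, pp. 23–25), at a single large length `N`
  (`q = ⌊cN/5⌋`, `w = ⌊cN/50⌋`, `δ = c³u/(3200μ²)`);
* **`Zd.DuminilCopinHammond2013_thm2_5_holds : DuminilCopinHammond2013_thm2_5`** — the named fact of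
  `SAWSubBallistic.lean`, DISCHARGED;
* **`Zd.tendsto_bridgeCount_div_pow_zero (d) (hd : 2 ≤ d) : b_n/μ^n → 0`** and
  `Zd.not_summable_mul_irreducibleBridgeCount_div_pow'` — the unconditional forms of
  `Zd.tendsto_bridgeCount_div_pow_zero_of_DCH` / `tendsto_bridgeCount_div_pow_zero_iff`.
DEVIATIONS from the printed proof (labelled in the component files): diamond-point density in expectation under the
uniform law on `B_N` instead of the ergodic theorem for the bi-infinite measure (Lemma 4.1, Prop. 4.2); the
stickbreak counted at fixed length `N → N + 2` instead of at a fixed number of renewal points.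
-/

noncomputable section

open Finset MeasureTheory Filter Topology Literature.Probability.LatticeModels Literature.Probability.Percolation
open scoped BigOperators

namespace Literature.Probability.RandomPlanarGeometry.SAW.Zd

variable {d : ℕ}

/-- **Duminil-Copin–Hammond 2013, Theorem 2.5, on `ℤ^{d+2}`**: the mean length of an irreducible bridge under
Kesten's law `P_iSAB(γ) = μ^{-|γ|}` is infinite, `Σ_k k λ_k μ^{-k} = ∞`. Proof (DCH §4, re-organised at fixed
length): were the series summable, the renewal theorem would give `b_N μ^{-N} → u > 0`; narrow bridges (S1a) with
many diamond times (S2 ⇒ S3) are then a positive fraction of `B_N`, and the stickbreak (S4) turns them into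
`≳ q²/(N+1)² · #B_N` WIDE bridges of length `N+2` — more than the `o(μ^{N+2})` wide bridges allowed by S1a.
[cite: DuminilCopinHammond2013, Theorem 2.5 (arXiv v1, p. 8; proof §4, pp. 18–25)] -/
theorem not_summable_mul_irreducibleBridgeCount_div_pow :
    ¬ Summable fun k : ℕ => (k : ℝ) * ((irreducibleBridgeCount (d + 2) k : ℝ) / connectiveConstant (d + 2) ^ k) := by
  classical
  intro h
  have hμ : 0 < connectiveConstant (d + 2) := connectiveConstant_pos _
  set μ := connectiveConstant (d + 2) with hμdef
  -- the renewal theorem: `u_N → u∞ = 1/m > 0`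
  have hlim := tendsto_bridgeCount_div_pow_of_summable (d + 2) h
  set m : ℝ := ∑' k : ℕ, (k : ℝ) * ((irreducibleBridgeCount (d + 2) k : ℝ) / μ ^ k) with hm
  have hm_pos : 0 < m := by
    refine h.tsum_pos (fun k => by positivity) 1 ?_
    have h1 : (1 : ℝ) ≤ irreducibleBridgeCount (d + 2) 1 := by
      exact_mod_cast one_le_irreducibleBridgeCount_one
    have : (0 : ℝ) < (irreducibleBridgeCount (d + 2) 1 : ℝ) / μ ^ 1 := by positivity
    simpa using this
  set u : ℝ := m⁻¹ with hu
  have hu_pos : 0 < u := inv_pos.2 hm_pos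
  -- S2, S3, S1
  obtain ⟨ρ, hρ, k₀, hcone⟩ := cone_positivity h (renewalBridgeMeasure_cone_tail_tendsto_zero h)
  obtain ⟨c, hc, N₀, hdiam⟩ := exists_frac_bridges_many_diamondTimes hρ hcone
  have hε : (0 : ℝ) < c / 50 := by positivity
  have hθ : Tendsto (fun N : ℕ => (#((bridges (d + 2) N).filter fun γ => c / 50 * N < (xDev N γ : ℝ)) : ℝ) /
      connectiveConstant (d + 2) ^ N) atTop (𝓝 0) :=
    card_wide_bridges_div_pow_tendsto_zero h hε
  set θ : ℕ → ℝ := fun N =>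
    (#((bridges (d + 2) N).filter fun γ => c / 50 * N < (xDev N γ : ℝ)) : ℝ) / μ ^ N with hθdef
  have hθE : ∀ N, (#((bridges (d + 2) N).filter fun γ => c / 50 * N < (xDev N γ : ℝ)) : ℝ) = θ N * μ ^ N := by
    intro N
    rw [hθdef]
    dsimp only
    rw [div_mul_cancel₀ _ (pow_ne_zero _ hμ.ne')]
  -- the constants
  set δ : ℝ := c ^ 3 * u / (3200 * μ ^ 2) with hδdef
  have hδ : 0 < δ := by positivity
  have e1 : ∀ᶠ N : ℕ in atTop, θ N ≤ c * u / 4 := hθ.eventually_le_const (by positivity)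
  have e2 : ∀ᶠ N : ℕ in atTop, θ (N + 2) ≤ δ := (hθ.comp (tendsto_add_atTop_nat 2)).eventually_le_const hδ
  have e3 : ∀ᶠ N : ℕ in atTop, u / 2 ≤ (bridgeCount (d + 2) N : ℝ) / μ ^ N :=
    hlim.eventually_const_le (by linarith)
  have e4 : ∀ᶠ N : ℕ in atTop, N₀ ≤ N := eventually_ge_atTop N₀
  have e5 : ∀ᶠ N : ℕ in atTop, 20 / c + c ≤ (N : ℝ) :=
    tendsto_natCast_atTop_atTop.eventually_ge_atTop _
  obtain ⟨N, hN1, hN2, hN3, hN4, hN5⟩ := (e1.and (e2.and (e3.and (e4.and e5)))).exists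
  -- numerics at this `N`
  have hcN : 20 ≤ c * N := by
    have : 20 / c ≤ (N : ℝ) := le_trans (le_add_of_nonneg_right hc.le) hN5
    calc (20 : ℝ) = c * (20 / c) := by field_simp
      _ ≤ c * N := by gcongr
  have hcN' : 1 + 2 / 25 * c ≤ 4 / 25 * (c * N) := by
    have : c ≤ (N : ℝ) := le_trans (le_add_of_nonneg_left (by positivity)) hN5
    have hcc : c * c ≤ c * N := by gcongr
    nlinarith
  have hN1' : (1 : ℝ) ≤ N := by
    have hNpos : (0 : ℝ) < N := lt_of_lt_of_le (by positivity) hN5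
    have : N ≠ 0 := by rintro rfl; simp at hNpos
    exact_mod_cast Nat.one_le_iff_ne_zero.2 this
  set q : ℕ := ⌊c * N / 5⌋₊ with hqdef
  set w : ℕ := ⌊c / 50 * N⌋₊ with hwdef
  have hq_le : (q : ℝ) ≤ c * N / 5 := Nat.floor_le (by positivity)
  have hq_gt : c * N / 5 - 1 < q := by
    have := Nat.lt_floor_add_one (c * N / 5)
    rw [← hqdef] at this
    linarith
  have hw_le : (w : ℝ) ≤ c / 50 * N := Nat.floor_le (by positivity)
  have h4wq : 4 * w < q := by
    have : (4 * w : ℝ) < q := by linarith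
    exact_mod_cast this
  have hq_ge : c * N / 10 ≤ q := by linarith
  have hq_ge' : 2 * (c / 50 * ((N : ℝ) + 2)) ≤ q := by linarith
  -- S4
  have hS4 := sq_mul_card_le_card_wide_stickbreak (d := d) N q w h4wq
  -- lower bound for `#G`
  set G := (bridges (d + 2) N).filter fun γ => 5 * q ≤ #(diamondTimes N γ) ∧ xDev N γ ≤ w with hGdef
  set D := (bridges (d + 2) N).filter fun γ => c * N ≤ (#(diamondTimes N γ) : ℝ) with hDdef
  set E := (bridges (d + 2) N).filter fun γ => c / 50 * N < (xDev N γ : ℝ) with hEdef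
  have hDGE : D ⊆ G ∪ E := by
    intro γ hγ
    rw [hDdef, mem_filter] at hγ
    rw [mem_union, hGdef, hEdef, mem_filter, mem_filter]
    by_cases hx : c / 50 * N < (xDev N γ : ℝ)
    · exact Or.inr ⟨hγ.1, hx⟩
    · refine Or.inl ⟨hγ.1, ?_, ?_⟩
      · have : (5 * q : ℝ) ≤ #(diamondTimes N γ) := by linarith [hγ.2]
        exact_mod_cast this
      · exact Nat.le_floor (not_lt.1 hx)
  have hG : c * bridgeCount (d + 2) N - θ N * μ ^ N ≤ #G := by
    have h1 : (#D : ℝ) ≤ #G + #E := by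
      exact_mod_cast (card_le_card hDGE).trans (card_union_le _ _)
    have h2 := hdiam N hN4
    rw [← hDdef] at h2
    rw [← hθE N]
    linarith
  -- upper bound for `#W`
  set W := (bridges (d + 2) (N + 2)).filter fun γ' => q < 2 * xDev (N + 2) γ' with hWdef
  set E2 := (bridges (d + 2) (N + 2)).filter fun γ => c / 50 * ↑(N + 2) < (xDev (N + 2) γ : ℝ) with hE2def
  have hWE : W ⊆ E2 := by
    intro γ hγ
    rw [hWdef, mem_filter] at hγ
    rw [hE2def, mem_filter]
    refine ⟨hγ.1, ?_⟩
    have : (q : ℝ) < 2 * xDev (N + 2) γ := by exact_mod_cast hγ.2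
    push_cast
    linarith
  have hW : (#W : ℝ) ≤ θ (N + 2) * μ ^ (N + 2) := by
    rw [← hθE (N + 2)]
    exact_mod_cast card_le_card hWE
  -- combine
  have hb : u / 2 * μ ^ N ≤ bridgeCount (d + 2) N := by
    have := hN3
    rwa [le_div_iff₀ (pow_pos hμ N)] at this
  have hLHS : (c * N / 10) ^ 2 * (c * u / 4 * μ ^ N) ≤ (q : ℝ) ^ 2 * #G := by
    have h1 : c * u / 4 * μ ^ N ≤ #G := by
      have : θ N * μ ^ N ≤ c * u / 4 * μ ^ N := by gcongr
      nlinarith [hG, hb, this, pow_pos hμ N]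
    have h2 : (c * N / 10) ^ 2 ≤ (q : ℝ) ^ 2 := by gcongr
    have h3 : (0 : ℝ) ≤ c * u / 4 * μ ^ N := by positivity
    calc (c * N / 10) ^ 2 * (c * u / 4 * μ ^ N) ≤ (q : ℝ) ^ 2 * (c * u / 4 * μ ^ N) := by gcongr
      _ ≤ (q : ℝ) ^ 2 * #G := by gcongr
  have hRHS : ((N : ℝ) + 1) ^ 2 * #W ≤ (2 * N) ^ 2 * (δ * μ ^ (N + 2)) := by
    have h1 : (#W : ℝ) ≤ δ * μ ^ (N + 2) := hW.trans (by gcongr)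
    have h2 : ((N : ℝ) + 1) ^ 2 ≤ (2 * N) ^ 2 := by gcongr; linarith
    calc ((N : ℝ) + 1) ^ 2 * #W ≤ ((N : ℝ) + 1) ^ 2 * (δ * μ ^ (N + 2)) := by gcongr
      _ ≤ (2 * N) ^ 2 * (δ * μ ^ (N + 2)) := by gcongr
  have key : (c * N / 10) ^ 2 * (c * u / 4 * μ ^ N) ≤ (2 * N) ^ 2 * (δ * μ ^ (N + 2)) :=
    hLHS.trans (hS4.trans hRHS)
  -- `key` reads `c³ u N² μ^N / 400 ≤ c³ u N² μ^N / 800`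
  rw [hδdef, pow_add] at key
  have hpos : 0 < c ^ 3 * u * (N : ℝ) ^ 2 * μ ^ N := by positivity
  have : (c * N / 10) ^ 2 * (c * u / 4 * μ ^ N) = c ^ 3 * u * (N : ℝ) ^ 2 * μ ^ N / 400 := by ring
  rw [this] at key
  have : (2 * (N : ℝ)) ^ 2 * (c ^ 3 * u / (3200 * μ ^ 2) * (μ ^ N * μ ^ 2)) =
      c ^ 3 * u * (N : ℝ) ^ 2 * μ ^ N / 800 := by
    field_simp
    ring
  rw [this] at key
  linarith


/-- **Duminil-Copin–Hammond 2013, Theorem 2.5** — "We have that `E_iSAB(|γ|) = ∞`" — in every dimension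
`d ≥ 2`: the tree's named fact `DuminilCopinHammond2013_thm2_5` (of `SAWSubBallistic.lean`), DISCHARGED.
[cite: DuminilCopinHammond2013, Theorem 2.5 (arXiv v1, p. 8; proof §4, pp. 18–25)] -/
theorem DuminilCopinHammond2013_thm2_5_holds : DuminilCopinHammond2013_thm2_5 := by
  intro d _ hd
  obtain ⟨d', rfl⟩ : ∃ d', d = d' + 2 := ⟨d - 2, by omega⟩
  intro hsum
  apply not_summable_mul_irreducibleBridgeCount_div_pow (d := d')
  refine hsum.congr fun n => ?_
  rw [inv_pow, div_eq_mul_inv, mul_assoc]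

/-- **`b_N μ^{-N} → 0` on `ℤ^d` for every `d ≥ 2`, UNCONDITIONALLY** — the statement Madras–Slade (1993, p. 91)
record as "believed … no known proof", which follows from Duminil-Copin–Hammond's Theorem 2.5 (2013) by the
renewal theorem (the tree's `tendsto_bridgeCount_div_pow_zero_of_DCH`, now fed with the proved fact).
[cite: DuminilCopinHammond2013, Theorem 2.5; MadrasSlade1993, §4.2, p. 91 and Theorem 4.2.2 (b)] -/
theorem tendsto_bridgeCount_div_pow_zero (d : ℕ) [NeZero d] (hd : 2 ≤ d) :
    Tendsto (fun n => (bridgeCount d n : ℝ) / connectiveConstant d ^ n) atTop (𝓝 0) :=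
  tendsto_bridgeCount_div_pow_zero_of_DCH d DuminilCopinHammond2013_thm2_5_holds hd

/-- Equivalently: the mean irreducible-bridge length `Σ_k k λ_k μ^{-k}` diverges on `ℤ^d`, `d ≥ 2`, in the
normalisation of `SAWBridgeRenewalLimit.lean`. [cite: DuminilCopinHammond2013, Theorem 2.5] -/
theorem not_summable_mul_irreducibleBridgeCount_div_pow' (d : ℕ) [NeZero d] (hd : 2 ≤ d) :
    ¬ Summable fun k : ℕ => (k : ℝ) * ((irreducibleBridgeCount d k : ℝ) / connectiveConstant d ^ k) :=
  (tendsto_bridgeCount_div_pow_zero_iff d).1 (tendsto_bridgeCount_div_pow_zero d hd)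


end Literature.Probability.RandomPlanarGeometry.SAW.Zd

end
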